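import Mathlib
import Literature.MathematicalPhysics.StatisticalMechanics.BarlowStackingEnergy
import Literature.MathematicalPhysics.StatisticalMechanics.MuGroundStateConfiguration
import Summits.AtomisticToContinuum.Crystallization.Theorems.PhononSlackCertificatesPeriodicGivenLayeredLayerCake3

/-!
# Route `NashClassCertificates`, crux `NashNearField` (stmt-AtomisticToContinuum-16827), line `birth`:
# pieces for the stub `stub_cauchyBornSitewiseOfCoercivity`, I — strained layer sums

Strained-layer vocabulary for a homogeneously deformed Barlow stacking `G · T_t` (`G` a continuous linear map of
`ℝ³` with `‖G v‖ ≥ (4/5)‖v‖`, `T_t` the unit template `barlowPos 1 (√6/3) t` of an ARBITRARY word `t`):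

* the strained pair term `Φ_q(k) = V_LJ (dist (G x_k) (G x_q))` (`x_k = barlowPos 1 (√6/3) t k 0 0` the base point of
  layer `k`, `x_q` the unit-template site `q ∈ ℤ³`) and the strained site energy `S_t(k) = ½ ∑'_q Φ_q(k)` of `G · T_t`
  (written out in every statement: the file introduces no definitions);
* `sw_sum_layer_le`, `sw_sum_inLayer_le` — uniform layer bounds: the interaction with a strained layer at layer
  distance `d ≠ 0` is `≤ 3240 / d⁴` in absolute value, the punctured in-layer sum is `≤ 11520` (pointwise majorant
  `|V_LJ ‖G v‖| ≤ (15/2) (‖v‖²)⁻³` from the tube bound, then the inverse-cube layer sum `cake_sum_layer_inv_cube_le`);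
* `sw_partial_le`, `sw_summable`, `sw_abs_site_le` — every finite partial sum of `|Φ_q(k)|` is `≤ 24480`, so the family
  is summable and `|S_t(k)| ≤ 12240`, uniformly in the word and in `G`;
All `[folklore]`.
-/

noncomputable section

open scoped BigOperators
open Literature.MathematicalPhysics.StatisticalMechanics

namespace Summit.AtomisticToContinuum.Crystallization.Theorems.NashClassCertificatesNashNearField

open Summit.AtomisticToContinuum.Crystallization.Theorems.LayeredHull
  (cake_sum_layer_inv_cube_le cake_abs_height_le_norm cake_le_norm_layerVec_inLayer cake_norm_layerVec_sq)

/-! ## Constants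

All statements are about explicit lattice sums (the file introduces no definitions).  The constants:
`|V_LJ ‖G v‖| ≤ (15/2) (‖v‖²)⁻³` for `‖v‖ ≥ 4/5` in the tube (pointwise majorant); a strained layer at layer distance
`d ≠ 0` contributes `≤ 3240 / d⁴`; the punctured strained in-layer sum is `≤ 11520`; every finite partial sum of the
absolute strained site sum `∑_q |V_LJ (dist (G x_k) (G x_q))|` (`x_k = barlowPos 1 (√6/3) t k 0 0`, `x_q` the
unit-template site `q ∈ ℤ³`) is `≤ 24480 = 11520 + 4·3240`. -/


/-- `4/5 ≤ √6/3`. [folklore] -/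
theorem sw_h0_ge : (4 / 5 : ℝ) ≤ Real.sqrt 6 / 3 := by
  rw [le_div_iff₀ (by norm_num : (0:ℝ) < 3)]
  rw [show (4 / 5 * 3 : ℝ) = 12 / 5 by norm_num]
  exact (Real.le_sqrt' (by norm_num)).2 (by norm_num)

/-- `(√6/3)⁴ = 4/9`. [folklore] -/
theorem sw_h0_pow_four : (Real.sqrt 6 / 3) ^ 4 = 4 / 9 := by
  have h6 : Real.sqrt 6 ^ 2 = 6 := Real.sq_sqrt (by norm_num)
  rw [div_pow, show Real.sqrt 6 ^ 4 = (Real.sqrt 6 ^ 2) ^ 2 by ring, h6]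
  norm_num

/-! ## The pointwise majorant in the tube -/

/-- **Pointwise majorant.** If `‖G v‖ ≥ (4/5)‖v‖` for all `v`, then for `‖v‖ ≥ 4/5`,
`|V_LJ ‖G v‖| ≤ (15/2) · (‖v‖²)⁻³` (`((3/5)⁻⁶/12 + 1/6)·(4/5)⁻⁶ ≈ 7.45`). [folklore] -/
theorem sw_abs_lj_strain_le (G : EuclideanSpace ℝ (Fin 3) →L[ℝ] EuclideanSpace ℝ (Fin 3))
    (hG : ∀ v, 4 / 5 * ‖v‖ ≤ ‖G v‖) {v : EuclideanSpace ℝ (Fin 3)} (hv : 4 / 5 ≤ ‖v‖) :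
    |lennardJones ‖G v‖| ≤ (15 / 2 : ℝ) * ((‖v‖ ^ 2)⁻¹) ^ 3 := by
  have hGv := hG v
  have h1 : 3 / 5 ≤ ‖G v‖ := by linarith
  have hv0 : 0 < ‖v‖ := by linarith
  have hGv0 : 0 < ‖G v‖ := by linarith
  have h2 := abs_lennardJones_le_of_le (ρ := 3 / 5) (by norm_num) h1
  have h3 : ‖G v‖⁻¹ ^ 6 ≤ (4 / 5 : ℝ)⁻¹ ^ 6 * ((‖v‖ ^ 2)⁻¹) ^ 3 := by
    have h4 : ‖G v‖⁻¹ ≤ (4 / 5 : ℝ)⁻¹ * ‖v‖⁻¹ := by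
      rw [← mul_inv]
      exact inv_anti₀ (by positivity) hGv
    calc ‖G v‖⁻¹ ^ 6 ≤ ((4 / 5 : ℝ)⁻¹ * ‖v‖⁻¹) ^ 6 := pow_le_pow_left₀ (by positivity) h4 6
      _ = (4 / 5 : ℝ)⁻¹ ^ 6 * ((‖v‖ ^ 2)⁻¹) ^ 3 := by rw [mul_pow]; congr 1; ring
  calc |lennardJones ‖G v‖| ≤ ((3 / 5 : ℝ)⁻¹ ^ 6 / 12 + 1 / 6) * ‖G v‖⁻¹ ^ 6 := h2
    _ ≤ ((3 / 5 : ℝ)⁻¹ ^ 6 / 12 + 1 / 6) * ((4 / 5 : ℝ)⁻¹ ^ 6 * ((‖v‖ ^ 2)⁻¹) ^ 3) :=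
        mul_le_mul_of_nonneg_left h3 (by positivity)
    _ = (((3 / 5 : ℝ)⁻¹ ^ 6 / 12 + 1 / 6) * (4 / 5 : ℝ)⁻¹ ^ 6) * ((‖v‖ ^ 2)⁻¹) ^ 3 := by ring
    _ ≤ (15 / 2 : ℝ) * ((‖v‖ ^ 2)⁻¹) ^ 3 := mul_le_mul_of_nonneg_right (by norm_num) (by positivity)

/-- Re-indexing of the height: `layerVec a h δ d i j = layerVec a (d h) δ 1 i j`. [folklore] -/
theorem sw_layerVec_height (a h : ℝ) (δ d i j : ℤ) :
    layerVec a h δ d i j = layerVec a ((d : ℝ) * h) δ 1 i j := by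
  ext l
  fin_cases l <;> simp [layerVec, layerNormal, triangularVec₁, triangularVec₂, barlowOffset]

/-! ## Uniform layer bounds -/

/-- **Strained layer bound.** For `d ≠ 0`, any offset `δ` and any finite `u ⊆ ℤ²`:
`∑_{(i,j) ∈ u} |V_LJ ‖G (layerVec 1 (√6/3) δ d i j)‖| ≤ 3240 / d⁴` (`= (15/2)·192·(9/4)`). [folklore] -/
theorem sw_sum_layer_le (G : EuclideanSpace ℝ (Fin 3) →L[ℝ] EuclideanSpace ℝ (Fin 3))
    (hG : ∀ v, 4 / 5 * ‖v‖ ≤ ‖G v‖) (δ : ℤ) {d : ℤ} (hd : d ≠ 0) (u : Finset (ℤ × ℤ)) :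
    ∑ ij ∈ u, |lennardJones ‖G (layerVec 1 (Real.sqrt 6 / 3) δ d ij.1 ij.2)‖| ≤
      (3240 : ℝ) * (((d : ℝ)) ^ 4)⁻¹ := by
  set H : ℝ := (d : ℝ) * (Real.sqrt 6 / 3) with hH
  have hd1 : (1 : ℝ) ≤ |(d : ℝ)| := by
    rw [← Int.cast_abs]; exact_mod_cast Int.one_le_abs hd
  have hHabs : 4 / 5 ≤ |H| := by
    rw [hH, abs_mul, abs_of_pos (by positivity : (0:ℝ) < Real.sqrt 6 / 3)]
    nlinarith [sw_h0_ge]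
  have hH7 : 7 / 10 ≤ |H| := by linarith
  have hpt : ∀ ij : ℤ × ℤ, |lennardJones ‖G (layerVec 1 (Real.sqrt 6 / 3) δ d ij.1 ij.2)‖| ≤
      (15 / 2 : ℝ) * ((‖layerVec 1 H δ 1 ij.1 ij.2‖ ^ 2)⁻¹) ^ 3 := by
    intro ij
    rw [sw_layerVec_height, ← hH]
    apply sw_abs_lj_strain_le G hG
    exact hHabs.trans (cake_abs_height_le_norm 1 H δ ij.1 ij.2)
  have hsum := cake_sum_layer_inv_cube_le 1 H (by norm_num) le_rfl hH7 δ u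
  have hH4 : H ^ 4 = (d : ℝ) ^ 4 * (4 / 9) := by rw [hH, mul_pow, sw_h0_pow_four]
  have hd4 : 0 < (d : ℝ) ^ 4 := by
    have : (d : ℝ) ≠ 0 := by exact_mod_cast hd
    positivity
  calc ∑ ij ∈ u, |lennardJones ‖G (layerVec 1 (Real.sqrt 6 / 3) δ d ij.1 ij.2)‖|
      ≤ ∑ ij ∈ u, (15 / 2 : ℝ) * ((‖layerVec 1 H δ 1 ij.1 ij.2‖ ^ 2)⁻¹) ^ 3 := Finset.sum_le_sum fun ij _ => hpt ij
    _ = (15 / 2 : ℝ) * ∑ ij ∈ u, ((‖layerVec 1 H δ 1 ij.1 ij.2‖ ^ 2)⁻¹) ^ 3 := by rw [Finset.mul_sum]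
    _ ≤ (15 / 2 : ℝ) * (192 / H ^ 4) := mul_le_mul_of_nonneg_left hsum (show (0 : ℝ) ≤ 15 / 2 by norm_num)
    _ = (3240 : ℝ) * ((d : ℝ) ^ 4)⁻¹ := by
        rw [hH4]
        field_simp
        ring

/-- **Strained in-layer bound.** For any finite `u ⊆ ℤ²`:
`∑_{(i,j) ∈ u} |V_LJ ‖G (layerVec 1 (√6/3) 0 0 i j)‖| ≤ 11520` (`= 8·(15/2)·192`; the origin contributes `V_LJ 0 = 0`).
[folklore] -/
theorem sw_sum_inLayer_le (G : EuclideanSpace ℝ (Fin 3) →L[ℝ] EuclideanSpace ℝ (Fin 3))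
    (hG : ∀ v, 4 / 5 * ‖v‖ ≤ ‖G v‖) (u : Finset (ℤ × ℤ)) :
    ∑ ij ∈ u, |lennardJones ‖G (layerVec 1 (Real.sqrt 6 / 3) 0 0 ij.1 ij.2)‖| ≤ (11520 : ℝ) := by
  have h0 : ∀ ij : ℤ × ℤ, layerVec 1 (Real.sqrt 6 / 3) 0 0 ij.1 ij.2 = layerVec 1 0 0 1 ij.1 ij.2 := by
    intro ij
    rw [sw_layerVec_height]
    simp
  -- comparison of the in-layer vector with the fictitious-height vector
  have hsq : ∀ ij : ℤ × ℤ, ‖layerVec 1 1 0 1 ij.1 ij.2‖ ^ 2 = ‖layerVec 1 0 0 1 ij.1 ij.2‖ ^ 2 + 1 := by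
    intro ij
    rw [cake_norm_layerVec_sq, cake_norm_layerVec_sq]
    ring
  have hpt : ∀ ij : ℤ × ℤ, |lennardJones ‖G (layerVec 1 (Real.sqrt 6 / 3) 0 0 ij.1 ij.2)‖| ≤
      8 * (15 / 2 : ℝ) * ((‖layerVec 1 1 0 1 ij.1 ij.2‖ ^ 2)⁻¹) ^ 3 := by
    intro ij
    rw [h0]
    by_cases hij : ij = 0
    · have hv : layerVec 1 0 0 1 ij.1 ij.2 = 0 := by
        rw [hij]
        ext l
        fin_cases l <;> simp [layerVec, layerNormal, triangularVec₁, triangularVec₂, barlowOffset]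
      rw [hv, map_zero, norm_zero, lennardJones_zero, abs_zero]
      have := (show (0 : ℝ) ≤ 15 / 2 by norm_num)
      positivity
    · have hij' : (ij.1, ij.2) ≠ 0 := by rwa [Prod.mk.eta]
      have h1 : 1 ≤ ‖layerVec 1 0 0 1 ij.1 ij.2‖ := cake_le_norm_layerVec_inLayer 1 zero_le_one hij'
      have h2 := sw_abs_lj_strain_le G hG (v := layerVec 1 0 0 1 ij.1 ij.2) (by linarith)
      refine h2.trans ?_
      set X : ℝ := ‖layerVec 1 0 0 1 ij.1 ij.2‖ ^ 2 with hX
      have hX1 : 1 ≤ X := by rw [hX]; nlinarith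
      have hW : ‖layerVec 1 1 0 1 ij.1 ij.2‖ ^ 2 = X + 1 := hsq ij
      rw [hW]
      have hX0 : 0 < X := by linarith
      have hle : (X⁻¹) ^ 3 ≤ 8 * ((X + 1)⁻¹) ^ 3 := by
        rw [show (8 : ℝ) * ((X + 1)⁻¹) ^ 3 = ((X + 1) / 2)⁻¹ ^ 3 by
          rw [inv_div, div_pow, inv_pow]; ring]
        exact pow_le_pow_left₀ (by positivity) (inv_anti₀ (by positivity) (by linarith)) 3
      nlinarith [(show (0 : ℝ) ≤ 15 / 2 by norm_num)]
  have hsum := cake_sum_layer_inv_cube_le 1 1 (by norm_num) le_rfl (by norm_num) 0 u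
  calc ∑ ij ∈ u, |lennardJones ‖G (layerVec 1 (Real.sqrt 6 / 3) 0 0 ij.1 ij.2)‖|
      ≤ ∑ ij ∈ u, 8 * (15 / 2 : ℝ) * ((‖layerVec 1 1 0 1 ij.1 ij.2‖ ^ 2)⁻¹) ^ 3 :=
        Finset.sum_le_sum fun ij _ => hpt ij
    _ = 8 * (15 / 2 : ℝ) * ∑ ij ∈ u, ((‖layerVec 1 1 0 1 ij.1 ij.2‖ ^ 2)⁻¹) ^ 3 := by rw [Finset.mul_sum]
    _ ≤ 8 * (15 / 2 : ℝ) * (192 / 1 ^ 4) := mul_le_mul_of_nonneg_left hsum (by have := (show (0 : ℝ) ≤ 15 / 2 by norm_num); positivity)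
    _ = (11520 : ℝ) := by ring

/-! ## One-dimensional tail sums -/

/-- `∑_{0 < j < M} j⁻² ≤ 2`. [folklore] -/
theorem sw_sum_Ioo_inv_sq_le (M : ℕ) : ∑ j ∈ Finset.Ioo 0 M, ((j : ℝ) ^ 2)⁻¹ ≤ 2 := by
  have h := sum_Ioo_inv_sq_le (α := ℝ) 0 M
  norm_num at h
  exact h

/-- Shifted tail: over any finite set of integers, `∑_{ℓ > k} (ℓ - k)⁻² ≤ 2`. [folklore] -/
theorem sw_sum_inv_sq_gt (L : Finset ℤ) (k : ℤ) :
    ∑ ℓ ∈ L, (if k < ℓ then ((((ℓ - k : ℤ)) : ℝ) ^ 2)⁻¹ else 0) ≤ 2 := by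
  classical
  rw [← Finset.sum_filter]
  set L' := L.filter (fun ℓ => k < ℓ) with hL'
  set φ : ℤ → ℕ := fun ℓ => (ℓ - k).toNat with hφ
  have hinj : Set.InjOn φ ↑L' := by
    intro x hx y hy hxy
    simp only [hL', Finset.coe_filter, Set.mem_setOf_eq] at hx hy
    simp only [hφ] at hxy
    have := congrArg (fun n : ℕ => (n : ℤ)) hxy
    simp only [Int.toNat_of_nonneg (show 0 ≤ x - k by omega), Int.toNat_of_nonneg (show 0 ≤ y - k by omega)] at this
    omega
  have hterm : ∀ ℓ ∈ L', ((((ℓ - k : ℤ)) : ℝ) ^ 2)⁻¹ = (((φ ℓ : ℕ) : ℝ) ^ 2)⁻¹ := by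
    intro ℓ hℓ
    simp only [hL', Finset.mem_filter] at hℓ
    have h1 : ((φ ℓ : ℕ) : ℤ) = ℓ - k := Int.toNat_of_nonneg (by omega)
    have h2 : ((φ ℓ : ℕ) : ℝ) = ((ℓ - k : ℤ) : ℝ) := by exact_mod_cast h1
    rw [h2]
  rw [Finset.sum_congr rfl hterm, ← Finset.sum_image (f := fun n : ℕ => ((n : ℝ) ^ 2)⁻¹) hinj]
  set M : ℕ := (L'.image φ).sup id + 1 with hM
  have hsub : L'.image φ ⊆ Finset.Ioo 0 M := by
    intro n hn
    rw [Finset.mem_Ioo]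
    obtain ⟨ℓ, hℓ, rfl⟩ := Finset.mem_image.1 hn
    simp only [hL', Finset.mem_filter] at hℓ
    constructor
    · simp only [hφ]; omega
    · have : φ ℓ ≤ (L'.image φ).sup id := Finset.le_sup (f := id) hn
      omega
  calc ∑ n ∈ L'.image φ, ((n : ℝ) ^ 2)⁻¹ ≤ ∑ n ∈ Finset.Ioo 0 M, ((n : ℝ) ^ 2)⁻¹ :=
        Finset.sum_le_sum_of_subset_of_nonneg hsub fun n _ _ => by positivity
    _ ≤ 2 := sw_sum_Ioo_inv_sq_le M

/-- Shifted tail, mirrored: `∑_{ℓ < k} (k - ℓ)⁻² ≤ 2`. [folklore] -/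
theorem sw_sum_inv_sq_lt (L : Finset ℤ) (k : ℤ) :
    ∑ ℓ ∈ L, (if ℓ < k then ((((k - ℓ : ℤ)) : ℝ) ^ 2)⁻¹ else 0) ≤ 2 := by
  classical
  have h := sw_sum_inv_sq_gt (L.image fun ℓ => -ℓ) (-k)
  rw [Finset.sum_image fun x _ y _ hxy => neg_injective hxy] at h
  refine le_trans (le_of_eq (Finset.sum_congr rfl fun ℓ _ => ?_)) h
  by_cases hlt : ℓ < k
  · rw [if_pos hlt, if_pos (by omega), show -ℓ - -k = k - ℓ by ring]
  · rw [if_neg hlt, if_neg (by omega)]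

/-- `∑_{ℓ ≠ k} (ℓ - k)⁻⁴ ≤ 4` over any finite set of integers. [folklore] -/
theorem sw_sum_inv_four_ne (L : Finset ℤ) (k : ℤ) :
    ∑ ℓ ∈ L, (if ℓ = k then 0 else ((((ℓ - k : ℤ)) : ℝ) ^ 4)⁻¹) ≤ 4 := by
  have h1 := sw_sum_inv_sq_gt L k
  have h2 := sw_sum_inv_sq_lt L k
  have key : ∀ ℓ ∈ L, (if ℓ = k then 0 else ((((ℓ - k : ℤ)) : ℝ) ^ 4)⁻¹) ≤
      (if k < ℓ then ((((ℓ - k : ℤ)) : ℝ) ^ 2)⁻¹ else 0) +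
        (if ℓ < k then ((((k - ℓ : ℤ)) : ℝ) ^ 2)⁻¹ else 0) := by
    intro ℓ _
    by_cases hlk : ℓ = k
    · simp [hlk]
    · have hsq : (1 : ℝ) ≤ (((ℓ - k : ℤ)) : ℝ) ^ 2 := by
        have h1' : (1 : ℤ) ≤ |ℓ - k| := Int.one_le_abs (sub_ne_zero.2 hlk)
        have h2' : (1 : ℝ) ≤ |(((ℓ - k : ℤ)) : ℝ)| := by rw [← Int.cast_abs]; exact_mod_cast h1'
        nlinarith [sq_abs ((((ℓ - k : ℤ)) : ℝ))]
      have h4 : ((((ℓ - k : ℤ)) : ℝ) ^ 4)⁻¹ ≤ ((((ℓ - k : ℤ)) : ℝ) ^ 2)⁻¹ := by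
        apply inv_anti₀ (by positivity)
        nlinarith
      rw [if_neg hlk]
      rcases lt_or_gt_of_ne hlk with hlt | hgt
      · rw [if_neg (by omega), if_pos hlt, zero_add]
        have : (((k - ℓ : ℤ)) : ℝ) ^ 2 = (((ℓ - k : ℤ)) : ℝ) ^ 2 := by push_cast; ring
        rw [this]; exact h4
      · rw [if_pos hgt, if_neg (by omega), add_zero]
        exact h4
  calc ∑ ℓ ∈ L, (if ℓ = k then 0 else ((((ℓ - k : ℤ)) : ℝ) ^ 4)⁻¹)
      ≤ ∑ ℓ ∈ L, ((if k < ℓ then ((((ℓ - k : ℤ)) : ℝ) ^ 2)⁻¹ else 0) +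
          (if ℓ < k then ((((k - ℓ : ℤ)) : ℝ) ^ 2)⁻¹ else 0)) := Finset.sum_le_sum key
    _ ≤ 2 + 2 := by rw [Finset.sum_add_distrib]; exact add_le_add h1 h2
    _ = 4 := by norm_num

/-! ## The strained site lattice sum -/

/-- The strained pair term through `layerVec`: `Φ_{(ℓ,i,j)}(k) = V_LJ ‖G (layerVec 1 (√6/3) (L ℓ - L k) (ℓ - k) i j)‖`.
[folklore] -/
theorem swF_eq (G : EuclideanSpace ℝ (Fin 3) →L[ℝ] EuclideanSpace ℝ (Fin 3)) (t : ℤ → ℤ) (k ℓ i j : ℤ) :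
    lennardJones (dist (G (barlowPos 1 (Real.sqrt 6 / 3) t k 0 0)) (G (barlowPos 1 (Real.sqrt 6 / 3) t ℓ i j))) =
      lennardJones ‖G (layerVec 1 (Real.sqrt 6 / 3) (haggLabel t ℓ - haggLabel t k) (ℓ - k) i j)‖ := by
  rw [dist_comm, dist_eq_norm, ← map_sub, barlowPos_sub_barlowPos, sub_zero, sub_zero]

/-- Fiber bound, other layers: `∑_{(i,j) ∈ u} |Φ_{(ℓ,i,j)}(k)| ≤ 3240 / (ℓ - k)⁴` for `ℓ ≠ k`. [folklore] -/
theorem sw_fiber_layer_le (G : EuclideanSpace ℝ (Fin 3) →L[ℝ] EuclideanSpace ℝ (Fin 3))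
    (hG : ∀ v, 4 / 5 * ‖v‖ ≤ ‖G v‖) (t : ℤ → ℤ) (k : ℤ) {ℓ : ℤ} (hℓ : ℓ ≠ k) (u : Finset (ℤ × ℤ)) :
    ∑ ij ∈ u, |lennardJones (dist (G (barlowPos 1 (Real.sqrt 6 / 3) t k 0 0))
      (G (barlowPos 1 (Real.sqrt 6 / 3) t ℓ ij.1 ij.2)))| ≤ (3240 : ℝ) * ((((ℓ - k : ℤ)) : ℝ) ^ 4)⁻¹ := by
  have h := sw_sum_layer_le G hG (haggLabel t ℓ - haggLabel t k) (d := ℓ - k) (sub_ne_zero.2 hℓ) u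
  simp only [swF_eq]
  exact h

/-- Fiber bound, own layer: `∑_{(i,j) ∈ u} |Φ_{(k,i,j)}(k)| ≤ 11520`. [folklore] -/
theorem sw_fiber_self_le (G : EuclideanSpace ℝ (Fin 3) →L[ℝ] EuclideanSpace ℝ (Fin 3))
    (hG : ∀ v, 4 / 5 * ‖v‖ ≤ ‖G v‖) (t : ℤ → ℤ) (k : ℤ) (u : Finset (ℤ × ℤ)) :
    ∑ ij ∈ u, |lennardJones (dist (G (barlowPos 1 (Real.sqrt 6 / 3) t k 0 0))
      (G (barlowPos 1 (Real.sqrt 6 / 3) t k ij.1 ij.2)))| ≤ (11520 : ℝ) := by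
  have h := sw_sum_inLayer_le G hG u
  simp only [swF_eq, sub_self]
  exact h

/-- **Uniform partial-sum bound**: every finite partial sum of `|Φ_q(k)|` over `q ∈ ℤ³` is `≤ 24480`, for every word
`t`, every layer `k` and every `G` in the tube. [folklore] -/
theorem sw_partial_le (G : EuclideanSpace ℝ (Fin 3) →L[ℝ] EuclideanSpace ℝ (Fin 3))
    (hG : ∀ v, 4 / 5 * ‖v‖ ≤ ‖G v‖) (t : ℤ → ℤ) (k : ℤ) (U : Finset (ℤ × ℤ × ℤ)) :
    ∑ q ∈ U, |lennardJones (dist (G (barlowPos 1 (Real.sqrt 6 / 3) t k 0 0)) (G (barlowPos 1 (Real.sqrt 6 / 3) t q.1 q.2.1 q.2.2)))| ≤ (24480 : ℝ) := by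
  classical
  set L := U.image Prod.fst with hL
  set W := U.image Prod.snd with hW
  calc ∑ q ∈ U, |lennardJones (dist (G (barlowPos 1 (Real.sqrt 6 / 3) t k 0 0)) (G (barlowPos 1 (Real.sqrt 6 / 3) t q.1 q.2.1 q.2.2)))| ≤ ∑ q ∈ L ×ˢ W, |lennardJones (dist (G (barlowPos 1 (Real.sqrt 6 / 3) t k 0 0)) (G (barlowPos 1 (Real.sqrt 6 / 3) t q.1 q.2.1 q.2.2)))| :=
        Finset.sum_le_sum_of_subset_of_nonneg Finset.subset_product fun q _ _ => abs_nonneg _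
    _ = ∑ ℓ ∈ L, ∑ ij ∈ W, |lennardJones (dist (G (barlowPos 1 (Real.sqrt 6 / 3) t k 0 0))
          (G (barlowPos 1 (Real.sqrt 6 / 3) t ℓ ij.1 ij.2)))| := Finset.sum_product _ _ _
    _ ≤ ∑ ℓ ∈ L, ((if ℓ = k then (11520 : ℝ) else 0) + (3240 : ℝ) * (if ℓ = k then 0 else ((((ℓ - k : ℤ)) : ℝ) ^ 4)⁻¹)) := by
        refine Finset.sum_le_sum fun ℓ _ => ?_
        by_cases hℓ : ℓ = k
        · rw [if_pos hℓ, if_pos hℓ, mul_zero, add_zero, hℓ]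
          exact sw_fiber_self_le G hG t k W
        · rw [if_neg hℓ, if_neg hℓ, zero_add]
          exact sw_fiber_layer_le G hG t k hℓ W
    _ = (∑ ℓ ∈ L, (if ℓ = k then (11520 : ℝ) else 0)) +
          (3240 : ℝ) * ∑ ℓ ∈ L, (if ℓ = k then 0 else ((((ℓ - k : ℤ)) : ℝ) ^ 4)⁻¹) := by
        rw [Finset.sum_add_distrib, Finset.mul_sum]
    _ ≤ (11520 : ℝ) + (3240 : ℝ) * 4 := by
        apply add_le_add
        · rw [Finset.sum_ite_eq']
          split_ifs
          · exact le_rfl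
          · exact (show (0 : ℝ) ≤ 11520 by norm_num)
        · exact mul_le_mul_of_nonneg_left (sw_sum_inv_four_ne L k) (show (0 : ℝ) ≤ 3240 by norm_num)
    _ = (24480 : ℝ) := by ring

/-- The absolute strained site family is summable. [folklore] -/
theorem sw_summable_abs (G : EuclideanSpace ℝ (Fin 3) →L[ℝ] EuclideanSpace ℝ (Fin 3))
    (hG : ∀ v, 4 / 5 * ‖v‖ ≤ ‖G v‖) (t : ℤ → ℤ) (k : ℤ) :
    Summable fun q : ℤ × ℤ × ℤ => |lennardJones (dist (G (barlowPos 1 (Real.sqrt 6 / 3) t k 0 0)) (G (barlowPos 1 (Real.sqrt 6 / 3) t q.1 q.2.1 q.2.2)))| :=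
  summable_of_sum_le (fun _ => abs_nonneg _) (sw_partial_le G hG t k)

/-- **The strained site family is summable** (any word, any `G` in the tube). [folklore] -/
theorem sw_summable (G : EuclideanSpace ℝ (Fin 3) →L[ℝ] EuclideanSpace ℝ (Fin 3))
    (hG : ∀ v, 4 / 5 * ‖v‖ ≤ ‖G v‖) (t : ℤ → ℤ) (k : ℤ) :
    Summable fun q : ℤ × ℤ × ℤ => lennardJones (dist (G (barlowPos 1 (Real.sqrt 6 / 3) t k 0 0)) (G (barlowPos 1 (Real.sqrt 6 / 3) t q.1 q.2.1 q.2.2))) :=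
  (sw_summable_abs G hG t k).of_abs

/-- `∑'_q |Φ_q(k)| ≤ 24480`. [folklore] -/
theorem sw_tsum_abs_le (G : EuclideanSpace ℝ (Fin 3) →L[ℝ] EuclideanSpace ℝ (Fin 3))
    (hG : ∀ v, 4 / 5 * ‖v‖ ≤ ‖G v‖) (t : ℤ → ℤ) (k : ℤ) :
    ∑' q : ℤ × ℤ × ℤ, |lennardJones (dist (G (barlowPos 1 (Real.sqrt 6 / 3) t k 0 0)) (G (barlowPos 1 (Real.sqrt 6 / 3) t q.1 q.2.1 q.2.2)))| ≤ (24480 : ℝ) :=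
  Real.tsum_le_of_sum_le (fun _ => abs_nonneg _) (sw_partial_le G hG t k)

/-- **Uniform bound on the strained site energy**: `|S_t(k)| = |½ ∑'_q Φ_q(k)| ≤ 12240`. [folklore] -/
theorem sw_abs_site_le (G : EuclideanSpace ℝ (Fin 3) →L[ℝ] EuclideanSpace ℝ (Fin 3))
    (hG : ∀ v, 4 / 5 * ‖v‖ ≤ ‖G v‖) (t : ℤ → ℤ) (k : ℤ) :
    |(1 / 2 : ℝ) * ∑' q : ℤ × ℤ × ℤ, lennardJones (dist (G (barlowPos 1 (Real.sqrt 6 / 3) t k 0 0)) (G (barlowPos 1 (Real.sqrt 6 / 3) t q.1 q.2.1 q.2.2)))| ≤ (24480 : ℝ) / 2 := by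
  have h1 : ‖∑' q : ℤ × ℤ × ℤ, lennardJones (dist (G (barlowPos 1 (Real.sqrt 6 / 3) t k 0 0)) (G (barlowPos 1 (Real.sqrt 6 / 3) t q.1 q.2.1 q.2.2)))‖ ≤ ∑' q : ℤ × ℤ × ℤ, ‖lennardJones (dist (G (barlowPos 1 (Real.sqrt 6 / 3) t k 0 0)) (G (barlowPos 1 (Real.sqrt 6 / 3) t q.1 q.2.1 q.2.2)))‖ :=
    norm_tsum_le_tsum_norm (by simpa only [Real.norm_eq_abs] using sw_summable_abs G hG t k)
  simp only [Real.norm_eq_abs] at h1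
  have h2 := h1.trans (sw_tsum_abs_le G hG t k)
  rw [abs_mul, abs_of_pos (by norm_num : (0:ℝ) < 1 / 2)]
  linarith

/-- **Stub piece `stub_strainedSiteEnergyBound` (proved; registered form of `sw_abs_site_le`).**  For every continuous
linear `G` with `(4/5)‖v‖ ≤ ‖G v‖`, every word `t` and every layer `k`, the strained site energy
`½ ∑'_q V_LJ (dist (G x_k) (G x_q))` of `G · T_t` at layer `k` is at most `12240` in absolute value. [folklore] -/
theorem stub_strainedSiteEnergyBound :
    ∀ (G : EuclideanSpace ℝ (Fin 3) →L[ℝ] EuclideanSpace ℝ (Fin 3)),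
      (∀ v : EuclideanSpace ℝ (Fin 3), 4 / 5 * ‖v‖ ≤ ‖G v‖) → ∀ (t : ℤ → ℤ) (k : ℤ),
      |(1 / 2 : ℝ) * ∑' q : ℤ × ℤ × ℤ, lennardJones (dist (G (barlowPos 1 (Real.sqrt 6 / 3) t k 0 0))
        (G (barlowPos 1 (Real.sqrt 6 / 3) t q.1 q.2.1 q.2.2)))| ≤ 12240 :=
  fun G hG t k => (sw_abs_site_le G hG t k).trans (by norm_num)

end Summit.AtomisticToContinuum.Crystallization.Theorems.NashClassCertificatesNashNearField

end
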